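import Summits.AnomalousDissipation.AnomalousDissipation.Theorems.SolenoidalFractalHomogenisationLagrangianStepW7ThreeModeDefsR
import Summits.AnomalousDissipation.AnomalousDissipation.Theorems.SolenoidalFractalHomogenisationLagrangianStepTransverseSymbolLipschitzFrame
import HarnessLib

/-!
# K1L_D (stmt-AnomalousDissipation-27980), (ℓ3) (D-TH)₀ «frozen-frame W7» — THREE-MODE FORM INEQUALITY: FIBRE INSTANTIATION AT REAL WAVE VECTORS,
# and the window numbers of the TWISTED modal generator `4π²•P_{G₀ᵀK} T_{𝔸^{G₀}}(K)` (helper; `--supports stmt-AnomalousDissipation-27980 --as helper`)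

Port of `…W7ThreeModeFibre` (p4 g13 / this lineage g11) under the dictionary `transversalProj K ↦ transversalProjR q` (`q : Fin 3 → ℝ` an arbitrary REAL wave
vector; flat fibres `q = K`, frozen-frame fibres `q = twistFreq G₀ K = G₀ᵀK`), `kdot K ↦ rdot q`, `modalAdjGen 𝔸 K ↦ 4π²•transversalProjR (twistFreq G₀ K) ∘ symbT (Visc4.conj G₀ 𝔸) K`
(the viscous part of w1 g9's frozen chain right-hand side `CellChain.modeRHSθ`).  Prover ad-sawtooth-k1loc-p1 g16; memo `HOME/ad-sawtooth-k1loc-p1/g16/DTH-costline-k1locp1g16.md`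
§2 (finding F-p1g16-1: the distorted high-label tool of the (ℓ3) blocks is an ENGINE statement; its frozen-frame part is a fibre-wise port of the W7 chain).
* §1 `threeModeR3_form_le` / `threeModeR3_equiv` / `rampR3_pairing_le` — the abstract theorems of `…W7ThreeModeForm` instantiated on `ℂ³` with the projections
  `transversalProjR q_j` (self-adjoint idempotents: `inner_transversalProjR_comm`, `transversalProjR_idem` of `Literature/…/PassiveVectorTensorTwistedModalSymbol`);
* §2 the TWISTED modal generator: transversality of its output (`rdot_twistGen_eq_zero`), coercivity **`re_inner_twistGen_ge`** / `coercivity_twistGen`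
  (`4π²·lo·|G₀ᵀK|²‖w‖² ≤ Re⟪L w, w⟫` for `rdot (G₀ᵀK) w = 0` under `NearIso 𝔸 lo hi` — the `d_j` of the window), and the UPPER norm bound **`norm_twistGen_le`**
  (`‖L w‖ ≤ 4π²(hi + β/2)|G₀ᵀK|²‖w‖`, `OddSmall 𝔸 β` — the `Dmax`/`D0` of the window), through w1 g9's `SymbolLipschitz.re_inner_symbT_conj_bilin` and the flat
  real-vector bound `ThreeMode.abs_bsymb_le`;
* §3 `freqNormSq_twist_le` / `le_freqNormSq_twist` — the window numbers move inside their slack: `(1 − 3θ)²|K|² ≤ |G₀ᵀK|² ≤ (1 + 3θ)²|K|²` for `|G₀ − 1| ≤ θ ≤ 1/3`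
  entrywise.
No definitions, no sorry.  NOT a proof of any block, of `stub_Vmod_EHTthg`, of K1L_D or of AD; rung F-D1.A0.
[cite: BedrossianCotiZelati2017, §2 (hypocoercivity functional with a cross term)] [problem: turb]
-/

set_option linter.dupNamespace false

namespace Summit.AnomalousDissipation.AnomalousDissipation.Theorems.SolenoidalFractalHomogenisation.LagrangianStep.ThreeMode

open scoped InnerProductSpace

section FibreR

open Literature.Analysis.FluidPDE Literature.Analysis.FluidPDE.Torus
open Literature.Analysis.FunctionSpaces.Torus (freqNormSq freqNormSq_nonneg)

/-! ## §1 The form inequality, the equivalence and the ramp pairing at real wave vectors -/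

/-- **Three-mode form inequality on the fibre `ℂ³`, Leray projections at REAL wave vectors** (`threeModeV_form_le` with `P_j = transversalProjR q_j`;
transversality as `rdot`-conditions). -/
theorem threeModeR3_form_le (l e d0 dp dm dpp dmm dmin dtwo Dmax D0 : ℝ) (q0 qp qm : Fin 3 → ℝ)
    (w0 wp wm wpp wmm y0 yp ym ypp ymm : (EuclideanSpace ℂ (Fin 3)))
    (hw0 : rdot q0 w0 = 0) (hyp : rdot qp yp = 0) (hym : rdot qm ym = 0)
    (hl : 0 ≤ l) (he : 0 ≤ e) (hd0 : 0 ≤ d0) (hdmin : 0 ≤ dmin) (hD0 : 0 ≤ D0)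
    (hg0 : d0 * ‖w0‖ ^ 2 ≤ (⟪y0, w0⟫_ℂ).re) (hgp : dp * ‖wp‖ ^ 2 ≤ (⟪yp, wp⟫_ℂ).re)
    (hgm : dm * ‖wm‖ ^ 2 ≤ (⟪ym, wm⟫_ℂ).re) (hgpp : dpp * ‖wpp‖ ^ 2 ≤ (⟪ypp, wpp⟫_ℂ).re)
    (hgmm : dmm * ‖wmm‖ ^ 2 ≤ (⟪ymm, wmm⟫_ℂ).re)
    (hYp : ‖yp‖ ≤ Dmax * ‖wp‖) (hYm : ‖ym‖ ≤ Dmax * ‖wm‖) (hY0 : ‖y0‖ ≤ D0 * ‖w0‖)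
    (hp : dmin ≤ dp) (hm : dmin ≤ dm) (hpp : dtwo ≤ dpp) (hmm : dtwo ≤ dmm)
    (c1 : 8 * e * l ^ 2 ≤ dmin) (c2 : 4 * e * Dmax ^ 2 ≤ dmin) (c3 : e * l ^ 2 ≤ dtwo)
    (c4 : 32 * e ^ 2 * l ^ 2 * D0 ^ 2 ≤ d0 * dmin) :
    -2 * ((⟪y0, w0⟫_ℂ).re + (⟪yp, wp⟫_ℂ).re + (⟪ym, wm⟫_ℂ).re + (⟪ypp, wpp⟫_ℂ).re + (⟪ymm, wmm⟫_ℂ).re)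
        + e * xdotR l q0 qp qm w0 wp wm wpp wmm y0 yp ym
      ≤ -(e * l ^ 2 / 2) * (‖transversalProjR qp w0‖ ^ 2 + ‖transversalProjR qm w0‖ ^ 2)
        - (5 * dmin / 4) * (‖wp‖ ^ 2 + ‖wm‖ ^ 2) - dtwo * (‖wpp‖ ^ 2 + ‖wmm‖ ^ 2) - (7 * d0 / 4) * ‖w0‖ ^ 2 := by
  letI ipr : InnerProductSpace ℝ (EuclideanSpace ℂ (Fin 3)) := InnerProductSpace.rclikeToReal ℂ (EuclideanSpace ℂ (Fin 3))
  have hri : ∀ x z : (EuclideanSpace ℂ (Fin 3)), ⟪x, z⟫_ℝ = (⟪x, z⟫_ℂ).re := fun x z => real_inner_eq_re_inner ℂ x z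
  have hsa : ∀ (q : Fin 3 → ℝ) (x z : (EuclideanSpace ℂ (Fin 3))),
      ⟪(fun v => transversalProjR q v) x, z⟫_ℝ = ⟪x, (fun v => transversalProjR q v) z⟫_ℝ := by
    intro q x z; simp only [hri, inner_transversalProjR_comm]
  have hid : ∀ (q : Fin 3 → ℝ) (x : (EuclideanSpace ℂ (Fin 3))),
      (fun v => transversalProjR q v) ((fun v => transversalProjR q v) x) = (fun v => transversalProjR q v) x :=
    fun q x => transversalProjR_idem q x
  have hw0' : (fun v => transversalProjR q0 v) w0 = w0 := transversalProjR_eq_self_of_rdot_eq_zero q0 hw0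
  have hyp' : (fun v => transversalProjR qp v) yp = yp := transversalProjR_eq_self_of_rdot_eq_zero qp hyp
  have hym' : (fun v => transversalProjR qm v) ym = ym := transversalProjR_eq_self_of_rdot_eq_zero qm hym
  have h := threeModeV_form_le (E := (EuclideanSpace ℂ (Fin 3))) l e d0 dp dm dpp dmm dmin dtwo Dmax D0
    (fun v => transversalProjR q0 v) (fun v => transversalProjR qp v) (fun v => transversalProjR qm v)
    w0 wp wm wpp wmm y0 yp ym ypp ymm
    (hsa q0) (hid q0) hw0' (hsa qp) (hid qp) hyp' (hsa qm) (hid qm) hym'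
    hl he hd0 hdmin hD0
    (by rw [hri]; exact hg0) (by rw [hri]; exact hgp) (by rw [hri]; exact hgm) (by rw [hri]; exact hgpp)
    (by rw [hri]; exact hgmm) hYp hYm hY0 hp hm hpp hmm c1 c2 c3 c4
  have hsm : ∀ (r : ℝ) (v : (EuclideanSpace ℂ (Fin 3))), (@HSMul.hSMul ℝ (EuclideanSpace ℂ (Fin 3)) (EuclideanSpace ℂ (Fin 3)) (@instHSMul ℝ (EuclideanSpace ℂ (Fin 3)) ipr.toModule.toSMul) r v) = (r : ℂ) • v :=
    fun r v => rfl
  have hx : xdotV (E := (EuclideanSpace ℂ (Fin 3))) l (fun v => transversalProjR q0 v) (fun v => transversalProjR qp v)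
      (fun v => transversalProjR qm v) w0 wp wm wpp wmm y0 yp ym = xdotR l q0 qp qm w0 wp wm wpp wmm y0 yp ym := by
    simp only [xdotV, xdotR, dW0, dWp, dWm, bV, dW0R, dWpR, dWmR, bR, hri, hsm]
  simpa only [hri, hx] using h

/-- **Norm equivalence of the cross term on the fibre, real wave vector**: `2|e·Re⟪w₀, b⟫| ≤ eℓ√2 (‖w₀‖² + ‖w₊‖² + ‖w₋‖²)`. -/
theorem threeModeR3_equiv (l e : ℝ) (q0 : Fin 3 → ℝ) (w0 wp wm : (EuclideanSpace ℂ (Fin 3))) (hl : 0 ≤ l) (he : 0 ≤ e) :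
    2 * |e * (⟪w0, bR l q0 wp wm⟫_ℂ).re| ≤ e * l * Real.sqrt 2 * (‖w0‖ ^ 2 + ‖wp‖ ^ 2 + ‖wm‖ ^ 2) := by
  letI ipr : InnerProductSpace ℝ (EuclideanSpace ℂ (Fin 3)) := InnerProductSpace.rclikeToReal ℂ (EuclideanSpace ℂ (Fin 3))
  have hri : ∀ x z : (EuclideanSpace ℂ (Fin 3)), ⟪x, z⟫_ℝ = (⟪x, z⟫_ℂ).re := fun x z => real_inner_eq_re_inner ℂ x z
  have hsa : ∀ (x z : (EuclideanSpace ℂ (Fin 3))), ⟪(fun v => transversalProjR q0 v) x, z⟫_ℝ = ⟪x, (fun v => transversalProjR q0 v) z⟫_ℝ := by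
    intro x z; simp only [hri, inner_transversalProjR_comm]
  have hsm : ∀ (r : ℝ) (v : (EuclideanSpace ℂ (Fin 3))), (@HSMul.hSMul ℝ (EuclideanSpace ℂ (Fin 3)) (EuclideanSpace ℂ (Fin 3)) (@instHSMul ℝ (EuclideanSpace ℂ (Fin 3)) ipr.toModule.toSMul) r v) = (r : ℂ) • v :=
    fun r v => rfl
  have h := threeModeV_equiv (E := (EuclideanSpace ℂ (Fin 3))) l e (fun v => transversalProjR q0 v) w0 wp wm hsa (transversalProjR_idem q0) hl he
  have hb : bV (E := (EuclideanSpace ℂ (Fin 3))) l (fun v => transversalProjR q0 v) wp wm = bR l q0 wp wm := by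
    simp only [bV, bR, hsm]
  simpa only [hri, hb] using h

/-- **Ramp pairing on the fibre, real wave vector**: `|Re⟪w₀, P₀(w₊ − w₋)⟫| ≤ ‖w₀‖(‖w₊‖ + ‖w₋‖)`. -/
theorem rampR3_pairing_le (q0 : Fin 3 → ℝ) (w0 wp wm : (EuclideanSpace ℂ (Fin 3))) :
    |(⟪w0, transversalProjR q0 (wp - wm)⟫_ℂ).re| ≤ ‖w0‖ * (‖wp‖ + ‖wm‖) := by
  letI ipr : InnerProductSpace ℝ (EuclideanSpace ℂ (Fin 3)) := InnerProductSpace.rclikeToReal ℂ (EuclideanSpace ℂ (Fin 3))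
  have hri : ∀ x z : (EuclideanSpace ℂ (Fin 3)), ⟪x, z⟫_ℝ = (⟪x, z⟫_ℂ).re := fun x z => real_inner_eq_re_inner ℂ x z
  have hsa : ∀ (x z : (EuclideanSpace ℂ (Fin 3))), ⟪(fun v => transversalProjR q0 v) x, z⟫_ℝ = ⟪x, (fun v => transversalProjR q0 v) z⟫_ℝ := by
    intro x z; simp only [hri, inner_transversalProjR_comm]
  have h := rampV_pairing_le (E := (EuclideanSpace ℂ (Fin 3))) (fun v => transversalProjR q0 v) w0 wp wm hsa (transversalProjR_idem q0)
  simpa only [hri] using h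

/-- The cross term is `l·Y`: `Re⟪w₀, bR l q₀ w₊ w₋⟫ = l · Re⟪w₀, P₀(w₊ − w₋)⟫`. -/
theorem re_inner_bR (l : ℝ) (q0 : Fin 3 → ℝ) (w0 wp wm : (EuclideanSpace ℂ (Fin 3))) :
    (⟪w0, bR l q0 wp wm⟫_ℂ).re = l * (⟪w0, transversalProjR q0 (wp - wm)⟫_ℂ).re := by
  rw [bR, inner_smul_right, Complex.re_ofReal_mul]

/-! ## §2 The twisted modal generator `4π²•P_{G₀ᵀK} T_{𝔸^{G₀}}(K)`: transversality, coercivity, upper norm bound -/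

/-- `rdot q` kills the range of `transversalProjR q` — also at `q = 0` (where `rdot 0 = 0`). -/
theorem rdot_transversalProjR_all (q : Fin 3 → ℝ) (z : (EuclideanSpace ℂ (Fin 3))) : rdot q (transversalProjR q z) = 0 := by
  by_cases hq : q = 0
  · subst hq
    rw [rdot_apply]
    simp
  · exact rdot_transversalProjR hq z

/-- Transversality of the twisted generator's output: `(G₀ᵀK) · (4π²•P_{G₀ᵀK} T w) = 0`. -/
theorem rdot_twistGen_eq_zero (𝔹 : Visc4 (Fin 3)) (G₀ : Matrix (Fin 3) (Fin 3) ℝ) (K : Fin 3 → ℤ) (w : (EuclideanSpace ℂ (Fin 3))) :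
    rdot (twistFreq G₀ K) (((4 * Real.pi ^ 2 : ℝ) : ℂ) • transversalProjR (twistFreq G₀ K) (symbT 𝔹 K w)) = 0 := by
  rw [map_smul, rdot_transversalProjR_all, smul_zero]

/-- **Coercivity of the twisted generator on the twisted plane**: for `rdot (G₀ᵀK) w = 0` and `NearIso 𝔸 lo hi`,
`4π²·lo·|G₀ᵀK|²·‖w‖² ≤ Re⟪4π²•P_{G₀ᵀK} T_{𝔸^{G₀}}(K) w, w⟫`. -/
theorem re_inner_twistGen_ge {𝔸 : Visc4 (Fin 3)} {lo hi : ℝ} (h𝔸 : NearIso 𝔸 lo hi) (G₀ : Matrix (Fin 3) (Fin 3) ℝ) (K : Fin 3 → ℤ)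
    {w : (EuclideanSpace ℂ (Fin 3))} (hw : rdot (twistFreq G₀ K) w = 0) :
    4 * Real.pi ^ 2 * lo * ((∑ a, twistFreq G₀ K a ^ 2) * ‖w‖ ^ 2)
      ≤ (⟪((4 * Real.pi ^ 2 : ℝ) : ℂ) • transversalProjR (twistFreq G₀ K) (symbT (Visc4.conj G₀ 𝔸) K w), w⟫_ℂ).re := by
  have h1 := lo_mul_le_re_inner_symbT_conj h𝔸 G₀ (k := K) (z := w) hw
  have e1 : (⟪((4 * Real.pi ^ 2 : ℝ) : ℂ) • transversalProjR (twistFreq G₀ K) (symbT (Visc4.conj G₀ 𝔸) K w), w⟫_ℂ).re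
      = 4 * Real.pi ^ 2 * (⟪w, symbT (Visc4.conj G₀ 𝔸) K w⟫_ℂ).re := by
    rw [inner_smul_left, Complex.conj_ofReal, inner_transversalProjR_left_of_rdot_eq_zero _ hw, Complex.re_ofReal_mul,
      ← inner_conj_symm, Complex.conj_re]
  rw [e1]
  have hpi : 0 ≤ 4 * Real.pi ^ 2 := by positivity
  nlinarith [mul_le_mul_of_nonneg_left h1 hpi]

/-- Coercivity packaged with the constant in front: `(4π²·lo·|G₀ᵀK|²)·‖w‖² ≤ Re⟪L w, w⟫` (the `hg_j` hypotheses of `threeModeR3_form_le`). -/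
theorem coercivity_twistGen {𝔸 : Visc4 (Fin 3)} {lo hi : ℝ} (h𝔸 : NearIso 𝔸 lo hi) (G₀ : Matrix (Fin 3) (Fin 3) ℝ) (K : Fin 3 → ℤ)
    (w : (EuclideanSpace ℂ (Fin 3))) (hw : rdot (twistFreq G₀ K) w = 0) :
    (4 * Real.pi ^ 2 * lo * ∑ a, twistFreq G₀ K a ^ 2) * ‖w‖ ^ 2
      ≤ (⟪((4 * Real.pi ^ 2 : ℝ) : ℂ) • transversalProjR (twistFreq G₀ K) (symbT (Visc4.conj G₀ 𝔸) K w), w⟫_ℂ).re := by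
  have := re_inner_twistGen_ge h𝔸 G₀ K hw
  linarith [this]

/-- **Bilinear window bound of the conjugated symbol on the twisted plane**: for `u, w ⊥ G₀ᵀK`,
`Re⟪u, T_{𝔸^{G₀}}(K) w⟫ ≤ (hi + β/2)·|G₀ᵀK|²·‖w‖·‖u‖` (`NearIso 𝔸 lo hi`, `0 ≤ lo`, `0 ≤ hi`, `OddSmall 𝔸 β`, `0 ≤ β`). -/
theorem re_inner_symbT_conj_le_bilin {𝔸 : Visc4 (Fin 3)} {lo hi β : ℝ} (h𝔸 : NearIso 𝔸 lo hi) (hlo : 0 ≤ lo) (hhi : 0 ≤ hi)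
    (hodd : OddSmall 𝔸 β) (hβ : 0 ≤ β) (G₀ : Matrix (Fin 3) (Fin 3) ℝ) (K : Fin 3 → ℤ) {u w : (EuclideanSpace ℂ (Fin 3))}
    (hu : rdot (twistFreq G₀ K) u = 0) (hw : rdot (twistFreq G₀ K) w = 0) :
    (⟪u, symbT (Visc4.conj G₀ 𝔸) K w⟫_ℂ).re ≤ (hi + β / 2) * (∑ a, twistFreq G₀ K a ^ 2) * (‖w‖ * ‖u‖) := by
  obtain ⟨hur, hui⟩ := sum_re_mul_eq_zero_of_rdot_eq_zero hu
  obtain ⟨hwr, hwi⟩ := sum_re_mul_eq_zero_of_rdot_eq_zero hw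
  set q : Fin 3 → ℝ := twistFreq G₀ K with hq
  have h1 := abs_bsymb_le h𝔸 hlo hhi hodd hβ q (fun i => (w i).re) (fun j => (u j).re) hwr hur
  have h2 := abs_bsymb_le h𝔸 hlo hhi hodd hβ q (fun i => (w i).im) (fun j => (u j).im) hwi hui
  have hcs := sqrt_mul_add_sqrt_mul_le (a := ∑ i, (w i).re ^ 2) (b := ∑ i, (w i).im ^ 2)
    (c := ∑ i, (u i).re ^ 2) (d := ∑ i, (u i).im ^ 2) (by positivity) (by positivity) (by positivity) (by positivity)
  have hwn : Real.sqrt (∑ i, (w i).re ^ 2 + ∑ i, (w i).im ^ 2) = ‖w‖ := by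
    rw [← norm_sq_re_im, Real.sqrt_sq (norm_nonneg _)]
  have hun : Real.sqrt (∑ i, (u i).re ^ 2 + ∑ i, (u i).im ^ 2) = ‖u‖ := by
    rw [← norm_sq_re_im, Real.sqrt_sq (norm_nonneg _)]
  rw [hwn, hun] at hcs
  rw [SymbolLipschitz.re_inner_symbT_conj_bilin, ← hq]
  have hc : 0 ≤ (hi + β / 2) * ∑ a, q a ^ 2 := mul_nonneg (by linarith) (by positivity)
  calc bsymb 𝔸 q (fun i => (w i).re) (fun j => (u j).re) + bsymb 𝔸 q (fun i => (w i).im) (fun j => (u j).im)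
      ≤ (hi + β / 2) * (∑ a, q a ^ 2) * (Real.sqrt (∑ i, (w i).re ^ 2) * Real.sqrt (∑ i, (u i).re ^ 2))
        + (hi + β / 2) * (∑ a, q a ^ 2) * (Real.sqrt (∑ i, (w i).im ^ 2) * Real.sqrt (∑ i, (u i).im ^ 2)) :=
        add_le_add (le_trans (le_abs_self _) h1) (le_trans (le_abs_self _) h2)
    _ = (hi + β / 2) * (∑ a, q a ^ 2) * (Real.sqrt (∑ i, (w i).re ^ 2) * Real.sqrt (∑ i, (u i).re ^ 2)
        + Real.sqrt (∑ i, (w i).im ^ 2) * Real.sqrt (∑ i, (u i).im ^ 2)) := by ring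
    _ ≤ (hi + β / 2) * (∑ a, q a ^ 2) * (‖w‖ * ‖u‖) := mul_le_mul_of_nonneg_left hcs hc

/-- **UPPER NORM BOUND of the twisted generator on the twisted plane** — the `Dmax`/`D0` hypotheses of `threeModeR3_form_le`:
`‖4π²•P_{G₀ᵀK} T_{𝔸^{G₀}}(K) w‖ ≤ 4π²·(hi + β/2)·|G₀ᵀK|²·‖w‖` for `rdot (G₀ᵀK) w = 0` (`NearIso 𝔸 lo hi`, `0 ≤ lo`, `0 ≤ hi`, `OddSmall 𝔸 β`, `0 ≤ β`). -/
theorem norm_twistGen_le {𝔸 : Visc4 (Fin 3)} {lo hi β : ℝ} (h𝔸 : NearIso 𝔸 lo hi) (hlo : 0 ≤ lo) (hhi : 0 ≤ hi)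
    (hodd : OddSmall 𝔸 β) (hβ : 0 ≤ β) (G₀ : Matrix (Fin 3) (Fin 3) ℝ) (K : Fin 3 → ℤ) (w : (EuclideanSpace ℂ (Fin 3)))
    (hw : rdot (twistFreq G₀ K) w = 0) :
    ‖((4 * Real.pi ^ 2 : ℝ) : ℂ) • transversalProjR (twistFreq G₀ K) (symbT (Visc4.conj G₀ 𝔸) K w)‖
      ≤ 4 * Real.pi ^ 2 * (hi + β / 2) * (∑ a, twistFreq G₀ K a ^ 2) * ‖w‖ := by
  set L : (EuclideanSpace ℂ (Fin 3)) := ((4 * Real.pi ^ 2 : ℝ) : ℂ) • transversalProjR (twistFreq G₀ K) (symbT (Visc4.conj G₀ 𝔸) K w) with hL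
  have hu : rdot (twistFreq G₀ K) L = 0 := rdot_twistGen_eq_zero _ G₀ K w
  have e1 : (⟪L, L⟫_ℂ).re = ‖L‖ ^ 2 := by
    have := inner_self_eq_norm_sq (𝕜 := ℂ) L
    simpa using this
  have e2 : (⟪L, L⟫_ℂ).re = 4 * Real.pi ^ 2 * (⟪L, symbT (Visc4.conj G₀ 𝔸) K w⟫_ℂ).re := by
    conv_lhs => rw [show L = ((4 * Real.pi ^ 2 : ℝ) : ℂ) • transversalProjR (twistFreq G₀ K) (symbT (Visc4.conj G₀ 𝔸) K w) from hL]
    rw [inner_smul_right, inner_transversalProjR_right_of_rdot_eq_zero _ hu, Complex.re_ofReal_mul]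
  have h3 := re_inner_symbT_conj_le_bilin h𝔸 hlo hhi hodd hβ G₀ K hu hw
  have hsq : ‖L‖ ^ 2 ≤ (4 * Real.pi ^ 2 * (hi + β / 2) * (∑ a, twistFreq G₀ K a ^ 2) * ‖w‖) * ‖L‖ := by
    rw [← e1, e2]
    have hpi : 0 ≤ 4 * Real.pi ^ 2 := by positivity
    nlinarith [mul_le_mul_of_nonneg_left h3 hpi]
  have hR : 0 ≤ 4 * Real.pi ^ 2 * (hi + β / 2) * (∑ a, twistFreq G₀ K a ^ 2) * ‖w‖ := by
    have : 0 ≤ hi + β / 2 := by linarith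
    positivity
  by_cases h0 : ‖L‖ = 0
  · rw [h0]; exact hR
  · have hpos : 0 < ‖L‖ := lt_of_le_of_ne (norm_nonneg _) (Ne.symm h0)
    rw [pow_two] at hsq
    exact le_of_mul_le_mul_right hsq hpos

/-! ## §3 The window numbers move inside their slack: `(1 − 3θ)²|K|² ≤ |G₀ᵀK|² ≤ (1 + 3θ)²|K|²` -/

/-- `|Σ_a K_a (G₀ − 1)_{ab}| ≤ θ·Σ_a |K_a|` for `|G₀ − 1| ≤ θ` entrywise. -/
theorem abs_twistFreq_sub_le {G₀ : Matrix (Fin 3) (Fin 3) ℝ} {θ : ℝ} (hG : ∀ i j, |G₀ i j - (1 : Matrix (Fin 3) (Fin 3) ℝ) i j| ≤ θ)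
    (K : Fin 3 → ℤ) (b : Fin 3) : |twistFreq G₀ K b - (K b : ℝ)| ≤ θ * ∑ a, |(K a : ℝ)| := by
  have e : twistFreq G₀ K b - (K b : ℝ) = ∑ a, (K a : ℝ) * (G₀ a b - (1 : Matrix (Fin 3) (Fin 3) ℝ) a b) := by
    rw [twistFreq_apply]
    have h1 : (K b : ℝ) = ∑ a, (K a : ℝ) * (1 : Matrix (Fin 3) (Fin 3) ℝ) a b := by
      rw [Finset.sum_eq_single b]
      · simp
      · intro a _ hab; simp [Matrix.one_apply_ne hab]
      · intro h; exact absurd (Finset.mem_univ b) h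
    rw [h1, ← Finset.sum_sub_distrib]
    exact Finset.sum_congr rfl fun a _ => by ring
  rw [e, Finset.mul_sum]
  refine (Finset.abs_sum_le_sum_abs _ _).trans (Finset.sum_le_sum fun a _ => ?_)
  rw [abs_mul]
  calc |(K a : ℝ)| * |G₀ a b - (1 : Matrix (Fin 3) (Fin 3) ℝ) a b| ≤ |(K a : ℝ)| * θ :=
        mul_le_mul_of_nonneg_left (hG a b) (abs_nonneg _)
    _ = θ * |(K a : ℝ)| := mul_comm _ _

/-- `(Σ_a |K_a|)² ≤ 3·|K|²` on `ℤ³` (Cauchy–Schwarz). -/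
theorem sum_abs_sq_le_three_mul_freqNormSq (K : Fin 3 → ℤ) : (∑ a, |(K a : ℝ)|) ^ 2 ≤ 3 * freqNormSq K := by
  have e : freqNormSq K = ∑ a, |(K a : ℝ)| ^ 2 := by
    rw [freqNormSq]
    exact Finset.sum_congr rfl fun a _ => by rw [sq_abs]
  rw [e, Fin.sum_univ_three, Fin.sum_univ_three]
  nlinarith [sq_nonneg (|(K 0 : ℝ)| - |(K 1 : ℝ)|), sq_nonneg (|(K 1 : ℝ)| - |(K 2 : ℝ)|), sq_nonneg (|(K 0 : ℝ)| - |(K 2 : ℝ)|)]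

/-- **Euclidean distance of the twisted frequency from the mode**: `|G₀ᵀK − K|² ≤ 9θ²|K|²` for `|G₀ − 1| ≤ θ` entrywise, `0 ≤ θ`. -/
theorem sum_sq_twistFreq_sub_le {G₀ : Matrix (Fin 3) (Fin 3) ℝ} {θ : ℝ} (hθ : 0 ≤ θ)
    (hG : ∀ i j, |G₀ i j - (1 : Matrix (Fin 3) (Fin 3) ℝ) i j| ≤ θ) (K : Fin 3 → ℤ) :
    ∑ b, (twistFreq G₀ K b - (K b : ℝ)) ^ 2 ≤ 9 * θ ^ 2 * freqNormSq K := by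
  have hS : 0 ≤ ∑ a, |(K a : ℝ)| := Finset.sum_nonneg fun a _ => abs_nonneg _
  have hb : ∀ b, (twistFreq G₀ K b - (K b : ℝ)) ^ 2 ≤ (θ * ∑ a, |(K a : ℝ)|) ^ 2 := fun b => by
    have h := abs_twistFreq_sub_le hG K b
    have h0 : 0 ≤ θ * ∑ a, |(K a : ℝ)| := mul_nonneg hθ hS
    calc (twistFreq G₀ K b - (K b : ℝ)) ^ 2 = |twistFreq G₀ K b - (K b : ℝ)| ^ 2 := (sq_abs _).symm
      _ ≤ (θ * ∑ a, |(K a : ℝ)|) ^ 2 := pow_le_pow_left₀ (abs_nonneg _) h 2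
  calc ∑ b, (twistFreq G₀ K b - (K b : ℝ)) ^ 2 ≤ ∑ _b : Fin 3, (θ * ∑ a, |(K a : ℝ)|) ^ 2 := Finset.sum_le_sum fun b _ => hb b
    _ = 3 * (θ ^ 2 * (∑ a, |(K a : ℝ)|) ^ 2) := by rw [Finset.sum_const, Finset.card_univ, Fintype.card_fin]; ring
    _ ≤ 3 * (θ ^ 2 * (3 * freqNormSq K)) := by
        have := sum_abs_sq_le_three_mul_freqNormSq K
        nlinarith [sq_nonneg θ]
    _ = 9 * θ ^ 2 * freqNormSq K := by ring

/-- The expansion `|G₀ᵀK|² = |K|² + 2·Σ_b K_b (G₀ᵀK − K)_b + |G₀ᵀK − K|²`. -/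
theorem sum_sq_twistFreq_expand (G₀ : Matrix (Fin 3) (Fin 3) ℝ) (K : Fin 3 → ℤ) :
    ∑ b, twistFreq G₀ K b ^ 2 = freqNormSq K + 2 * ∑ b, (K b : ℝ) * (twistFreq G₀ K b - (K b : ℝ))
      + ∑ b, (twistFreq G₀ K b - (K b : ℝ)) ^ 2 := by
  rw [freqNormSq, Finset.mul_sum, ← Finset.sum_add_distrib, ← Finset.sum_add_distrib]
  exact Finset.sum_congr rfl fun b _ => by ring

/-- The cross sum is controlled by Cauchy–Schwarz: `(Σ_b K_b (G₀ᵀK − K)_b)² ≤ |K|²·|G₀ᵀK − K|²`. -/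
theorem cross_sq_le (G₀ : Matrix (Fin 3) (Fin 3) ℝ) (K : Fin 3 → ℤ) :
    (∑ b, (K b : ℝ) * (twistFreq G₀ K b - (K b : ℝ))) ^ 2 ≤ freqNormSq K * ∑ b, (twistFreq G₀ K b - (K b : ℝ)) ^ 2 := by
  rw [freqNormSq]
  exact Finset.sum_mul_sq_le_sq_mul_sq _ _ _

/-- **Upper window**: `|G₀ᵀK|² ≤ (1 + 3θ)²·|K|²` for `|G₀ − 1| ≤ θ` entrywise, `0 ≤ θ`. -/
theorem freqNormSq_twist_le {G₀ : Matrix (Fin 3) (Fin 3) ℝ} {θ : ℝ} (hθ : 0 ≤ θ)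
    (hG : ∀ i j, |G₀ i j - (1 : Matrix (Fin 3) (Fin 3) ℝ) i j| ≤ θ) (K : Fin 3 → ℤ) :
    ∑ b, twistFreq G₀ K b ^ 2 ≤ (1 + 3 * θ) ^ 2 * freqNormSq K := by
  have hD := sum_sq_twistFreq_sub_le hθ hG K
  have hN0 : 0 ≤ freqNormSq K := freqNormSq_nonneg K
  have hC := cross_sq_le G₀ K
  set N := freqNormSq K
  set C := ∑ b, (K b : ℝ) * (twistFreq G₀ K b - (K b : ℝ))
  set D2 := ∑ b, (twistFreq G₀ K b - (K b : ℝ)) ^ 2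
  -- `C² ≤ N·D2 ≤ N·9θ²N = (3θN)²`, hence `C ≤ |C| ≤ 3θN`
  have hC2 : C ^ 2 ≤ (3 * θ * N) ^ 2 := by
    calc C ^ 2 ≤ N * D2 := hC
      _ ≤ N * (9 * θ ^ 2 * N) := mul_le_mul_of_nonneg_left hD hN0
      _ = (3 * θ * N) ^ 2 := by ring
  have hCle : C ≤ 3 * θ * N := (le_abs_self C).trans (abs_le_of_sq_le_sq'' hC2 (by positivity))
  have hexp : ∑ b, twistFreq G₀ K b ^ 2 = N + 2 * C + D2 := sum_sq_twistFreq_expand G₀ K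
  rw [hexp]
  nlinarith [hCle, hD, sq_nonneg θ]

/-- **Lower window**: `(1 − 3θ)²·|K|² ≤ |G₀ᵀK|²` for `|G₀ − 1| ≤ θ` entrywise, `0 ≤ θ ≤ 1/3`. -/
theorem le_freqNormSq_twist {G₀ : Matrix (Fin 3) (Fin 3) ℝ} {θ : ℝ} (hθ : 0 ≤ θ) (hθ3 : θ ≤ 1 / 3)
    (hG : ∀ i j, |G₀ i j - (1 : Matrix (Fin 3) (Fin 3) ℝ) i j| ≤ θ) (K : Fin 3 → ℤ) :
    (1 - 3 * θ) ^ 2 * freqNormSq K ≤ ∑ b, twistFreq G₀ K b ^ 2 := by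
  have hD := sum_sq_twistFreq_sub_le hθ hG K
  have hN0 : 0 ≤ freqNormSq K := freqNormSq_nonneg K
  have hC := cross_sq_le G₀ K
  set N := freqNormSq K
  set C := ∑ b, (K b : ℝ) * (twistFreq G₀ K b - (K b : ℝ))
  set D2 := ∑ b, (twistFreq G₀ K b - (K b : ℝ)) ^ 2
  have hD2 : 0 ≤ D2 := Finset.sum_nonneg fun b _ => sq_nonneg _
  -- square roots `A = √N`, `D = √D2`: `|C| ≤ A·D`, `D ≤ 3θA ≤ A`
  set A : ℝ := Real.sqrt N
  set D : ℝ := Real.sqrt D2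
  have hA0 : 0 ≤ A := Real.sqrt_nonneg _
  have hD0 : 0 ≤ D := Real.sqrt_nonneg _
  have hA2 : A ^ 2 = N := Real.sq_sqrt hN0
  have hDD : D ^ 2 = D2 := Real.sq_sqrt hD2
  have hCabs : |C| ≤ A * D := abs_le_of_sq_le_sq'' (by rw [mul_pow, hA2, hDD]; exact hC) (mul_nonneg hA0 hD0)
  have hDle : D ≤ 3 * θ * A := abs_le_of_sq_le_sq'' (by rw [hDD, mul_pow, mul_pow, hA2]; nlinarith [hD]) (by positivity)
    |> (le_abs_self D).trans
  have hCge : -(A * D) ≤ C := by have := neg_abs_le C; linarith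
  have hexp : ∑ b, twistFreq G₀ K b ^ 2 = N + 2 * C + D2 := sum_sq_twistFreq_expand G₀ K
  rw [hexp, ← hA2, ← hDD]
  -- `A² + 2C + D² ≥ A² − 2AD + D² = (A − D)² ≥ ((1 − 3θ)A)²`
  have h13 : 0 ≤ 1 - 3 * θ := by linarith
  have hAD : (1 - 3 * θ) * A ≤ A - D := by nlinarith [hDle]
  have hsq : ((1 - 3 * θ) * A) ^ 2 ≤ (A - D) ^ 2 := pow_le_pow_left₀ (mul_nonneg h13 hA0) hAD 2
  nlinarith [hsq, hCge]

end FibreR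

end Summit.AnomalousDissipation.AnomalousDissipation.Theorems.SolenoidalFractalHomogenisation.LagrangianStep.ThreeMode
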